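import Summits.Ventures.CertifiedManyBodySolver.Observables.SourcedTorusTTPrimeAHMToolkit
import Literature.MathematicalPhysics.QuantumLattice.ApproximatingHamiltonianGroundEnergy
import Literature.MathematicalPhysics.QuantumLattice.DWaveSourcePhaseRotation

/-!
# Bogoliubov Jr.'s approximating-Hamiltonian method for the pair-sourced `t–t'` torus WITH A BASE
# FIELD — 2/3: the hard half at `T = 0` (assembly)

Cell `hubbard-cq` (venture `CertifiedManyBodySolver`; lead RULING 93/98: model layer (β) + assembly,
importing the abstract `T = 0` theorem (α) of hubbard-cq-p1 and the phase rotation (γ) of hubbard-cq-p4).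
With `A_L(h) = dWaveSourceTorusTT' L t' U μ h`, `Δ_d = pairField dWaveFormFactor L` and the BCS-crutch
Hamiltonian with base field `H_{g,L}(h₀) = A_L(h₀) − (g/L²) Δ_dᴴ Δ_d` (file 1/3
`SourcedTorusTTPrimeAHMToolkit.lean`: channel algebra, locality constants, the easy half; file 3/3
`SourcedTorusTTPrimeT0AHMEnvelope.lean`: localisation, the two-sided package and the corollary on
`crutchTorusTT'` by name):

* `ahmTT'_groundEnergy_bound` — HARD HALF at `T = 0`, uniformly in `|μ| ≤ M` and `0 ≤ h₀ ≤ H₀`: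
  `∀ ε > 0 ∃ L₀ ∀ L ≥ L₀ ∃ h ≥ h₀`, `E₀(A_L(h)) + (h − h₀)²L²/g ≤ E₀(H_{g,L}(h₀)) + εL²`. ASSEMBLY of
  (α) the tree's abstract one-channel `T = 0` theorem `exists_groundEnergy_approx_add_sq_le_model`
  (`ApproximatingHamiltonianGroundEnergy.lean`) at `T = A_L(h₀)`, `W = √gΔ_d`, `V = L²`, whose
  hypotheses (A2)–(A3) are discharged by the MODEL-LAYER bounds (β) of the toolkit file
  (`‖W‖ ≤ √g‖P‖L²`, `‖[W,Wᴴ]‖ ≤ 25·2g‖P‖²L²`, `‖[W, A_L(h₀)]‖ ≤ √g κ L²` with `κ` bounded using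
  `|μ| ≤ |M|`, `|h₀| ≤ |H₀|`; trivial double commutators, whose `O(L⁴)` constants enter as `√(·)/L²`),
  and (γ) the phase rotation `groundEnergy_dWaveSourceTorusTT'_add_le_groundEnergy_sub_phaseSource`
  (`DWaveSourcePhaseRotation.lean`): the complex amplitude `c` becomes the field `h = h₀ + √g|c| ≥ h₀`
  with penalty EXACTLY `(h − h₀)²/g = |c|²`.

The `t' = h₀ = 0` thermal-route version is the tree's `stub_t0AHM` (crux `TwSeededEnsembleEquivalence`).
HONEST SCOPE / WHAT THIS IS NOT: `H_{g,L}` is the BCS-crutch Hamiltonian, NOT the Hubbard model;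
nothing at `g = 0`; no order-parameter floor, no phase sentence; finite torus, no thermodynamic limit.
Everything PROVED; no definition, no named fact. Default `DecidableEq (FermionTorus 2 L)` instance.

References: Bogolyubov Jr.–Brankov–Zagrebnov–Kurbatov–Tonchev, Russ. Math. Surveys 39:6 (1984);
Bru–de Siqueira Pedra, Mem. AMS 224 (2013), Appendix, Theorem 107; Koma–Tasaki (1994) §1.
-/

noncomputable section

namespace Summit.Ventures.CertifiedManyBodySolver.Observables.SourcedTorusAHM

open Matrix Finset Filter Topology Literature.MathematicalPhysics.QuantumLattice
open Literature.Probability.LatticeModels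
open Summit.HubbardSuperconductivity.HubbardSuperconductivity.Theorems
open Summit.HubbardSuperconductivity.HubbardSuperconductivity.Theorems.TwSeededEnsembleEquivalence.Negative
open scoped ComplexOrder Matrix.Norms.L2Operator ComplexConjugate

/-! ### The hard half at `T = 0`, uniformly in `|μ| ≤ M` and `0 ≤ h₀ ≤ H₀` -/

section ZeroTemperature

/-- **Hard half of the `T = 0` approximating-Hamiltonian bound with a base field**, uniformly in
`|μ| ≤ M` and `0 ≤ h₀ ≤ H₀`: `∀ ε > 0 ∃ L₀ ∀ L ≥ L₀ ∀ |μ| ≤ M ∀ h₀ ∈ [0, H₀] ∃ h ≥ h₀`,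
`E₀(A_L(h)) + (h − h₀)²L²/g ≤ E₀(A_L(h₀) − (g/L²)Δ_dᴴΔ_d) + εL²`.
Assembly: the abstract `T = 0` one-channel theorem `exists_groundEnergy_approx_add_sq_le_model` (α) at
`T = A_L(h₀)`, `W = √gΔ_d`, `V = L²`, accuracy `ε/2`, source radius `r = ε/(16(C₁+1))` and `L₀` with
`Q_∞(r)/L ≤ ε/4`; its hypotheses (A2)–(A3) from the toolkit's locality bounds (β); then the phase rotation
(γ) `E₀(A_L(h₀ + √g|c|)) ≤ E₀(A_L(h₀) − (c̄W + cWᴴ))` with `|c|² = (h − h₀)²/g`.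
Bogolyubov Jr. et al. (1984); Bru–de Siqueira Pedra (2013), Theorem 107 (ii). -/
theorem ahmTT'_groundEnergy_bound (tp U g M H₀ ε : ℝ) (hg : 0 < g) (hε : 0 < ε) :
    ∃ L₀ : ℕ, ∀ (L : ℕ) [NeZero L], L₀ ≤ L → ∀ μ : ℝ, |μ| ≤ M → ∀ h₀ : ℝ, 0 ≤ h₀ → h₀ ≤ H₀ →
      ∃ h : ℝ, h₀ ≤ h ∧
        (dWaveSourceTorusTT' L tp U μ h).groundEnergy + (h - h₀) ^ 2 * (L : ℝ) ^ 2 / g ≤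
          (dWaveSourceTorusTT' L tp U μ h₀ - ((g / (L : ℝ) ^ 2 : ℝ) : ℂ) •
              ((pairField dWaveFormFactor L)ᴴ * pairField dWaveFormFactor L)).groundEnergy +
            ε * (L : ℝ) ^ 2 := by
  have hT : ∀ (L : ℕ) [NeZero L] (μ h₀ : ℝ), (dWaveSourceTorusTT' L tp U μ h₀).IsHermitian :=
    fun L _ μ h₀ => dWaveSourceTorusTT'_isHermitian L tp U μ h₀
  have hsg : 0 < Real.sqrt g := Real.sqrt_pos.2 hg
  -- `L`-, `μ`- and `h₀`-independent constants (kept opaque: `positivity` must not unfold the sums)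
  obtain ⟨pd, hpd⟩ : ∃ pd : ℝ,
      pd = 2 * ∑ e ∈ insert (0 : Site 2) unitSteps, |dWaveFormFactor e / Real.sqrt 2| := ⟨_, rfl⟩
  have hpd0 : 0 ≤ pd := by rw [hpd]; positivity
  obtain ⟨a, ha⟩ : ∃ a : ℝ, a = Real.sqrt g := ⟨_, rfl⟩
  have ha0 : 0 < a := by rw [ha]; exact hsg
  obtain ⟨C₁, hC₁⟩ : ∃ C₁ : ℝ, C₁ = a * pd := ⟨_, rfl⟩
  have hC₁0 : 0 ≤ C₁ := by rw [hC₁]; positivity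
  obtain ⟨C₂, hC₂⟩ : ∃ C₂ : ℝ, C₂ = g * (25 * (2 * pd ^ 2)) := ⟨_, rfl⟩
  have hC₂0 : 0 ≤ C₂ := by rw [hC₂]; positivity
  obtain ⟨κ₀, hκ₀⟩ : ∃ κ₀ : ℝ, κ₀ = 45 * (2 * (2 * |(1 : ℝ)| + |U| + 2 * |M|) * pd) +
      45 * (2 * (2 * |tp|) * pd) + |H₀| * (25 * (2 * pd ^ 2)) := ⟨_, rfl⟩
  have hκ₀0 : 0 ≤ κ₀ := by rw [hκ₀]; positivity
  obtain ⟨c₃, hc₃⟩ : ∃ c₃ : ℝ, c₃ = 2 * C₁ * C₂ := ⟨_, rfl⟩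
  obtain ⟨c₄, hc₄⟩ : ∃ c₄ : ℝ, c₄ = 2 * C₁ * (a * κ₀) := ⟨_, rfl⟩
  have hc₃0 : 0 ≤ c₃ := by rw [hc₃]; positivity
  have hc₄0 : 0 ≤ c₄ := by rw [hc₄]; positivity
  obtain ⟨r, hr⟩ : ∃ r : ℝ, r = ε / (16 * (C₁ + 1)) := ⟨_, rfl⟩
  have hr0 : 0 < r := by rw [hr]; positivity
  obtain ⟨A₁, hA₁⟩ : ∃ A₁ : ℝ, A₁ = C₁ * (c₄ + c₃ * C₁) / r := ⟨_, rfl⟩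
  obtain ⟨B₁, hB₁⟩ : ∃ B₁ : ℝ, B₁ = C₁ * (2 * (C₂ / 2) ^ 2) / r := ⟨_, rfl⟩
  obtain ⟨A₂, hA₂⟩ : ∃ A₂ : ℝ, A₂ = C₁ * (c₄ + C₁ * c₃) / r := ⟨_, rfl⟩
  have hA₁0 : 0 ≤ A₁ := by rw [hA₁]; positivity
  have hB₁0 : 0 ≤ B₁ := by rw [hB₁]; positivity
  have hA₂0 : 0 ≤ A₂ := by rw [hA₂]; positivity
  obtain ⟨K, hK⟩ : ∃ K : ℝ, K = C₂ / 2 + (Real.sqrt (A₁ + B₁) + Real.sqrt (A₂ + 0)) / 2 :=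
    ⟨_, rfl⟩
  have hK0 : 0 ≤ K := by rw [hK]; positivity
  refine ⟨⌈4 * K / ε⌉₊ + 1, ?_⟩
  intro L _ hL μ hμ h₀ hh₀ hh₀H
  have hLpos : (0 : ℝ) < (L : ℝ) := by exact_mod_cast NeZero.pos L
  have hL1 : (1 : ℝ) ≤ (L : ℝ) := by exact_mod_cast NeZero.pos L
  have hV : (0 : ℝ) < (L : ℝ) ^ 2 := by positivity
  have hV1 : (1 : ℝ) ≤ (L : ℝ) ^ 2 := by nlinarith
  have hLK : 4 * K / ε ≤ (L : ℝ) := by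
    have h1 : (4 * K / ε : ℝ) ≤ (⌈4 * K / ε⌉₊ : ℝ) := Nat.le_ceil _
    have h2 : ((⌈4 * K / ε⌉₊ + 1 : ℕ) : ℝ) ≤ (L : ℝ) := by exact_mod_cast hL
    push_cast at h2
    linarith
  have hμM : |μ| ≤ |M| := hμ.trans (le_abs_self M)
  have hh₀M : |h₀| ≤ |H₀| := by rw [abs_of_nonneg hh₀]; exact hh₀H.trans (le_abs_self H₀)
  -- (β): the channel `W = a·Δ_d` and the hypotheses (A2)–(A3) in the box of side `L`
  have hΔn : ‖pairField dWaveFormFactor L‖ ≤ pd * (L : ℝ) ^ 2 := by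
    rw [hpd]; exact norm_pairField_le dWaveFormFactor L
  have hWn : ‖(((a : ℝ) : ℂ) • pairField dWaveFormFactor L)‖ =
      a * ‖pairField dWaveFormFactor L‖ := by rw [twAhm_norm_real_smul, abs_of_pos ha0]
  have hU : ‖(((a : ℝ) : ℂ) • pairField dWaveFormFactor L)‖ ≤ C₁ * (L : ℝ) ^ 2 := by
    rw [hWn, hC₁, mul_assoc]
    exact mul_le_mul_of_nonneg_left hΔn ha0.le
  have hWH : ‖((((a : ℝ) : ℂ) • pairField dWaveFormFactor L))ᴴ‖ =
      ‖(((a : ℝ) : ℂ) • pairField dWaveFormFactor L)‖ := l2_opNorm_conjTranspose _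
  have hWreal : ((((a : ℝ) : ℂ) • pairField dWaveFormFactor L))ᴴ =
      ((a : ℝ) : ℂ) • (pairField dWaveFormFactor L)ᴴ := by
    rw [conjTranspose_smul, Complex.star_def, Complex.conj_ofReal]
  have hcommW : (((a : ℝ) : ℂ) • pairField dWaveFormFactor L) *
        ((((a : ℝ) : ℂ) • pairField dWaveFormFactor L))ᴴ -
      ((((a : ℝ) : ℂ) • pairField dWaveFormFactor L))ᴴ *
        (((a : ℝ) : ℂ) • pairField dWaveFormFactor L) =
      ((a * a : ℝ) : ℂ) • (pairField dWaveFormFactor L * (pairField dWaveFormFactor L)ᴴ -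
        (pairField dWaveFormFactor L)ᴴ * pairField dWaveFormFactor L) := by
    rw [hWreal, smul_mul_smul_comm, smul_mul_smul_comm, ← smul_sub, Complex.ofReal_mul]
  have h2 : ‖(((a : ℝ) : ℂ) • pairField dWaveFormFactor L) *
        ((((a : ℝ) : ℂ) • pairField dWaveFormFactor L))ᴴ -
      ((((a : ℝ) : ℂ) • pairField dWaveFormFactor L))ᴴ *
        (((a : ℝ) : ℂ) • pairField dWaveFormFactor L)‖ ≤ (L : ℝ) ^ 2 * C₂ := by
    rw [hcommW, twAhm_norm_real_smul, abs_of_pos (mul_pos ha0 ha0),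
      show a * a = g by rw [ha]; exact Real.mul_self_sqrt hg.le, hC₂]
    have := twAhm_norm_comm_pairField_conjTranspose_le L dWaveFormFactor
    rw [← hpd] at this
    calc g * ‖pairField dWaveFormFactor L * (pairField dWaveFormFactor L)ᴴ -
          (pairField dWaveFormFactor L)ᴴ * pairField dWaveFormFactor L‖
        ≤ g * (25 * (2 * pd ^ 2) * (L : ℝ) ^ 2) := mul_le_mul_of_nonneg_left this hg.le
      _ = (L : ℝ) ^ 2 * (g * (25 * (2 * pd ^ 2))) := by ring
  have h2' : ‖⁅((((a : ℝ) : ℂ) • pairField dWaveFormFactor L))ᴴ,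
      (((a : ℝ) : ℂ) • pairField dWaveFormFactor L)⁆‖ ≤ (L : ℝ) ^ 2 * C₂ := by
    rw [Ring.lie_def, norm_sub_rev]; exact h2
  have h3a : ‖⁅(((a : ℝ) : ℂ) • pairField dWaveFormFactor L),
      ⁅((((a : ℝ) : ℂ) • pairField dWaveFormFactor L))ᴴ,
        (((a : ℝ) : ℂ) • pairField dWaveFormFactor L)⁆⁆‖ ≤
      (L : ℝ) ^ 2 * (c₃ * (L : ℝ) ^ 2) := by
    refine (twAhm_norm_lie_le _ _).trans ?_
    calc 2 * ‖(((a : ℝ) : ℂ) • pairField dWaveFormFactor L)‖ *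
          ‖⁅((((a : ℝ) : ℂ) • pairField dWaveFormFactor L))ᴴ,
            (((a : ℝ) : ℂ) • pairField dWaveFormFactor L)⁆‖
        ≤ 2 * (C₁ * (L : ℝ) ^ 2) * ((L : ℝ) ^ 2 * C₂) :=
          mul_le_mul (mul_le_mul_of_nonneg_left hU (by norm_num)) h2' (norm_nonneg _)
            (by positivity)
      _ = (L : ℝ) ^ 2 * (c₃ * (L : ℝ) ^ 2) := by rw [hc₃]; ring
  have h3b : ‖⁅((((a : ℝ) : ℂ) • pairField dWaveFormFactor L))ᴴ,
      ⁅((((a : ℝ) : ℂ) • pairField dWaveFormFactor L))ᴴ,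
        (((a : ℝ) : ℂ) • pairField dWaveFormFactor L)⁆⁆‖ ≤
      (L : ℝ) ^ 2 * (c₃ * (L : ℝ) ^ 2) := by
    refine (twAhm_norm_lie_le _ _).trans ?_
    rw [hWH]
    calc 2 * ‖(((a : ℝ) : ℂ) • pairField dWaveFormFactor L)‖ *
          ‖⁅((((a : ℝ) : ℂ) • pairField dWaveFormFactor L))ᴴ,
            (((a : ℝ) : ℂ) • pairField dWaveFormFactor L)⁆‖
        ≤ 2 * (C₁ * (L : ℝ) ^ 2) * ((L : ℝ) ^ 2 * C₂) :=
          mul_le_mul (mul_le_mul_of_nonneg_left hU (by norm_num)) h2' (norm_nonneg _)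
            (by positivity)
      _ = (L : ℝ) ^ 2 * (c₃ * (L : ℝ) ^ 2) := by rw [hc₃]; ring
  have hWK : ‖⁅(((a : ℝ) : ℂ) • pairField dWaveFormFactor L), dWaveSourceTorusTT' L tp U μ h₀⁆‖ ≤
      a * κ₀ * (L : ℝ) ^ 2 := by
    have hlie : ⁅(((a : ℝ) : ℂ) • pairField dWaveFormFactor L), dWaveSourceTorusTT' L tp U μ h₀⁆ =
        ((a : ℝ) : ℂ) • (pairField dWaveFormFactor L * dWaveSourceTorusTT' L tp U μ h₀ -
          dWaveSourceTorusTT' L tp U μ h₀ * pairField dWaveFormFactor L) := by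
      rw [Ring.lie_def, Matrix.smul_mul, Matrix.mul_smul, smul_sub]
    rw [hlie, twAhm_norm_real_smul, abs_of_pos ha0, mul_assoc]
    refine mul_le_mul_of_nonneg_left ?_ ha0.le
    have := ahmTT'_norm_comm_pairField_sourcedTT'_le L tp U μ h₀
    rw [← hpd] at this
    refine this.trans ?_
    rw [hκ₀]
    have hpdV : 0 ≤ pd * (L : ℝ) ^ 2 := by positivity
    have hpd2V : 0 ≤ 25 * (2 * pd ^ 2) * (L : ℝ) ^ 2 := by positivity
    have hfact := mul_le_mul_of_nonneg_right hμM hpdV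
    have hfact2 := mul_le_mul_of_nonneg_right hh₀M hpd2V
    linarith only [hfact, hfact2]
  have h4a : ‖⁅(((a : ℝ) : ℂ) • pairField dWaveFormFactor L),
      ⁅(((a : ℝ) : ℂ) • pairField dWaveFormFactor L), dWaveSourceTorusTT' L tp U μ h₀⁆⁆‖ ≤
      (L : ℝ) ^ 2 * (c₄ * (L : ℝ) ^ 2) := by
    refine (twAhm_norm_lie_le _ _).trans ?_
    calc 2 * ‖(((a : ℝ) : ℂ) • pairField dWaveFormFactor L)‖ *
          ‖⁅(((a : ℝ) : ℂ) • pairField dWaveFormFactor L), dWaveSourceTorusTT' L tp U μ h₀⁆‖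
        ≤ 2 * (C₁ * (L : ℝ) ^ 2) * (a * κ₀ * (L : ℝ) ^ 2) :=
          mul_le_mul (mul_le_mul_of_nonneg_left hU (by norm_num)) hWK (norm_nonneg _)
            (by positivity)
      _ = (L : ℝ) ^ 2 * (c₄ * (L : ℝ) ^ 2) := by rw [hc₄]; ring
  have h4b : ‖⁅((((a : ℝ) : ℂ) • pairField dWaveFormFactor L))ᴴ,
      ⁅(((a : ℝ) : ℂ) • pairField dWaveFormFactor L), dWaveSourceTorusTT' L tp U μ h₀⁆⁆‖ ≤
      (L : ℝ) ^ 2 * (c₄ * (L : ℝ) ^ 2) := by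
    refine (twAhm_norm_lie_le _ _).trans ?_
    rw [hWH]
    calc 2 * ‖(((a : ℝ) : ℂ) • pairField dWaveFormFactor L)‖ *
          ‖⁅(((a : ℝ) : ℂ) • pairField dWaveFormFactor L), dWaveSourceTorusTT' L tp U μ h₀⁆‖
        ≤ 2 * (C₁ * (L : ℝ) ^ 2) * (a * κ₀ * (L : ℝ) ^ 2) :=
          mul_le_mul (mul_le_mul_of_nonneg_left hU (by norm_num)) hWK (norm_nonneg _)
            (by positivity)
      _ = (L : ℝ) ^ 2 * (c₄ * (L : ℝ) ^ 2) := by rw [hc₄]; ring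
  -- (α): Bogoliubov Jr.'s `T = 0` estimate in the box of side `L`
  obtain ⟨c, hc⟩ := exists_groundEnergy_approx_add_sq_le_model (hT L μ h₀)
    ((((a : ℝ) : ℂ) • pairField dWaveFormFactor L)) hV hr0 hU h2 h3a h3b h4a h4b (half_pos hε)
  clear hU h2 h2' h3a h3b h4a h4b hWK hcommW hWreal hWH hWn hΔn
  -- the error is at most `ε`
  have h4r : 4 * r * C₁ ≤ ε / 4 := by
    rw [hr, show 4 * (ε / (16 * (C₁ + 1))) * C₁ = ε / 4 * (C₁ / (C₁ + 1)) by field_simp; ring]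
    have hC1 : 0 < C₁ + 1 := by linarith
    have h1 : C₁ / (C₁ + 1) ≤ 1 := (div_le_one hC1).2 (by linarith)
    have hε4 : 0 ≤ ε / 4 := by linarith
    calc ε / 4 * (C₁ / (C₁ + 1)) ≤ ε / 4 * 1 := mul_le_mul_of_nonneg_left h1 hε4
      _ = ε / 4 := mul_one _
  have hrad1 : C₁ * (c₄ * (L : ℝ) ^ 2 + 2 * (c₃ * (L : ℝ) ^ 2 / 2) * C₁ + 2 * (C₂ / 2) ^ 2) / r =
      A₁ * (L : ℝ) ^ 2 + B₁ := by
    rw [hA₁, hB₁]; field_simp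
  have hrad2 : C₁ * (c₄ * (L : ℝ) ^ 2 + 2 * C₁ * (c₃ * (L : ℝ) ^ 2 / 2)) / r =
      A₂ * (L : ℝ) ^ 2 + 0 := by
    rw [hA₂]; field_simp; ring
  have hsqL : Real.sqrt ((L : ℝ) ^ 2) = (L : ℝ) := Real.sqrt_sq hLpos.le
  have hs1 : Real.sqrt (C₁ * (c₄ * (L : ℝ) ^ 2 + 2 * (c₃ * (L : ℝ) ^ 2 / 2) * C₁ +
      2 * (C₂ / 2) ^ 2) / r) ≤ Real.sqrt (A₁ + B₁) * (L : ℝ) := by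
    rw [hrad1]
    calc Real.sqrt (A₁ * (L : ℝ) ^ 2 + B₁) ≤ Real.sqrt (A₁ + B₁) * Real.sqrt ((L : ℝ) ^ 2) :=
          twAhm_sqrt_affine_le hA₁0 hB₁0 hV1
      _ = Real.sqrt (A₁ + B₁) * (L : ℝ) := by rw [hsqL]
  have hs2 : Real.sqrt (C₁ * (c₄ * (L : ℝ) ^ 2 + 2 * C₁ * (c₃ * (L : ℝ) ^ 2 / 2)) / r) ≤
      Real.sqrt (A₂ + 0) * (L : ℝ) := by
    rw [hrad2]
    calc Real.sqrt (A₂ * (L : ℝ) ^ 2 + 0) ≤ Real.sqrt (A₂ + 0) * Real.sqrt ((L : ℝ) ^ 2) :=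
          twAhm_sqrt_affine_le hA₂0 le_rfl hV1
      _ = Real.sqrt (A₂ + 0) * (L : ℝ) := by rw [hsqL]
  have hQ : (C₂ / 2 +
      (Real.sqrt (C₁ * (c₄ * (L : ℝ) ^ 2 + 2 * (c₃ * (L : ℝ) ^ 2 / 2) * C₁ +
          2 * (C₂ / 2) ^ 2) / r) +
        Real.sqrt (C₁ * (c₄ * (L : ℝ) ^ 2 + 2 * C₁ * (c₃ * (L : ℝ) ^ 2 / 2)) / r)) / 2) /
      (L : ℝ) ^ 2 ≤ ε / 4 := by
    have hA0 : 0 ≤ C₂ / 2 := by positivity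
    have e1 : C₂ / 2 ≤ C₂ / 2 * (L : ℝ) := le_mul_of_one_le_right hA0 hL1
    have hnum : C₂ / 2 +
        (Real.sqrt (C₁ * (c₄ * (L : ℝ) ^ 2 + 2 * (c₃ * (L : ℝ) ^ 2 / 2) * C₁ +
            2 * (C₂ / 2) ^ 2) / r) +
          Real.sqrt (C₁ * (c₄ * (L : ℝ) ^ 2 + 2 * C₁ * (c₃ * (L : ℝ) ^ 2 / 2)) / r)) / 2 ≤
        K * (L : ℝ) := by
      rw [hK]
      linarith
    have hKL : K * (L : ℝ) / (L : ℝ) ^ 2 = K / (L : ℝ) := by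
      rw [pow_two, mul_div_mul_right _ _ hLpos.ne']
    have hKε : K / (L : ℝ) ≤ ε / 4 := by
      rw [div_le_iff₀ hLpos]
      have h1 := mul_le_mul_of_nonneg_left hLK (by positivity : (0 : ℝ) ≤ ε / 4)
      have h2 : ε / 4 * (4 * K / ε) = K := by field_simp
      linarith
    calc _ ≤ K * (L : ℝ) / (L : ℝ) ^ 2 := div_le_div_of_nonneg_right hnum hV.le
      _ = K / (L : ℝ) := hKL
      _ ≤ ε / 4 := hKε
  -- (γ): the complex amplitude becomes the field `h₀ + √g|c| ≥ h₀`
  rw [ha] at hc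
  rw [ahmTT'_model_eq L _ hg.le] at hc
  have happrox : dWaveSourceTorusTT' L tp U μ h₀ -
      (starRingEnd ℂ c • (((Real.sqrt g : ℝ) : ℂ) • pairField dWaveFormFactor L) +
        c • (((Real.sqrt g : ℝ) : ℂ) • pairField dWaveFormFactor L)ᴴ) =
      dWaveSourceTorusTT' L tp U μ h₀ -
        (starRingEnd ℂ (((Real.sqrt g : ℝ) : ℂ) * c) • pairField dWaveFormFactor L +
          (((Real.sqrt g : ℝ) : ℂ) * c) • (pairField dWaveFormFactor L)ᴴ) := by
    rw [conjTranspose_smul, Complex.star_def, Complex.conj_ofReal, smul_smul, smul_smul, map_mul,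
      Complex.conj_ofReal, mul_comm c, mul_comm ((starRingEnd ℂ) c)]
  rw [happrox] at hc
  have hγ := groundEnergy_dWaveSourceTorusTT'_add_le_groundEnergy_sub_phaseSource L tp U μ hh₀
    (((Real.sqrt g : ℝ) : ℂ) * c)
  have hz : ‖((Real.sqrt g : ℝ) : ℂ) * c‖ = Real.sqrt g * ‖c‖ := by
    rw [norm_mul, Complex.norm_real, Real.norm_of_nonneg hsg.le]
  rw [hz] at hγ
  refine ⟨h₀ + Real.sqrt g * ‖c‖, le_add_of_nonneg_right (by positivity), ?_⟩
  have hpen : (h₀ + Real.sqrt g * ‖c‖ - h₀) ^ 2 * (L : ℝ) ^ 2 / g = ‖c‖ ^ 2 * (L : ℝ) ^ 2 := by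
    rw [add_sub_cancel_left, mul_pow, Real.sq_sqrt hg.le]
    field_simp
  rw [hpen]
  -- extensive form of (α)
  have hadd := add_le_add h4r hQ
  have key : (dWaveSourceTorusTT' L tp U μ h₀ -
        (starRingEnd ℂ (((Real.sqrt g : ℝ) : ℂ) * c) • pairField dWaveFormFactor L +
          (((Real.sqrt g : ℝ) : ℂ) * c) • (pairField dWaveFormFactor L)ᴴ)).groundEnergy /
          (L : ℝ) ^ 2 + ‖c‖ ^ 2 ≤
      (dWaveSourceTorusTT' L tp U μ h₀ - ((g / (L : ℝ) ^ 2 : ℝ) : ℂ) •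
          ((pairField dWaveFormFactor L)ᴴ * pairField dWaveFormFactor L)).groundEnergy /
          (L : ℝ) ^ 2 + ε := by
    linarith only [hc, hadd]
  have key' := mul_le_mul_of_nonneg_right key hV.le
  rw [add_mul, add_mul, div_mul_cancel₀ _ hV.ne', div_mul_cancel₀ _ hV.ne'] at key'
  linarith only [key', hγ]

end ZeroTemperature

end Summit.Ventures.CertifiedManyBodySolver.Observables.SourcedTorusAHM

end
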